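import Summits.Ventures.CertifiedArithmetic.LowPrec.GemmThetaLawGenInt
import Summits.Ventures.CertifiedArithmetic.LowPrec.GemmPrecRoundingG

/-!
# Letter-dependent symbolic θ-certificates: a checked law is a θ-certificate (soundness, final)

HONEST FRAMING (venture CertifiedArithmetic / cell `pub-lowprec`, seat gemm, gen 12 → 13): certified
error envelopes and provably optimal rounding/accumulation schemes for low-precision formats under
stated cost models; every table by two implementations; no hardware or vendor claims.

Step (S5, rational half) of the soundness chain for `GemmThetaLawGenDefs.lean` (cell HANDOFF
decision 35; gen-13 resubmission: the grid equality is read through `div_left_inj'` inline — its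
lemma form is the landed `MiniFloat.dyadic_eq_iff` of `GemmDyadicStep.lean`): `lawCheck_cert` —
a law with `lawCheck = contOK = succOK = true` yields, for every format `φ` whose precision
parameter `K` (`M₀K = 2^manBits`) is admissible, whose exponent range contains the grid `2^-G`
(`qexp φ ≤ -G`) and whose overflow threshold exceeds the state range
(`2^(manBits+J+3) ≤ maxRat φ`), the θ-certificate
`ThetaCertificate φ Π_L S_L ψ_L θ(m) ρ β_pair κ(m)` of `GemmThetaCertificate.lean` for the alphabet
`Π_L = Λ·2^-G`; hence (by `ThetaCertificate.defect_bound`) the envelope of Prop. Θ(i) for every input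
word and every length.  The proof is the integer certificate `lawCheck_sound_int` read through the
grid bridge `flStep_grid_prec` / `gainOf_grid_prec` / `deficitOf_grid_prec` (every precision, every
dyadic grid; no saturation inside the state range).  The remaining hypotheses are sign conditions on
the law's constants (`θ`-numerator, `κ`-denominator positive; `ρ`, `β` numerators nonnegative) and the
smallness of the letters (`|z| < 2^(m+1)`), each decidable per law.
-/

namespace Literature.ComputerArithmetic.FloatingPoint

namespace MiniFloat

namespace ThetaLaw

namespace LawData

variable (L : LawData)

/-- A state has magnitude at most `2^(m+J+2)` (the top). [cell] -/
theorem stZ_natAbs_le {m : ℕ} {V : ℤ} (h : L.stZ m V) : V.natAbs ≤ 2 ^ (m + L.J + 2) := by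
  rcases h with h | ⟨j, t, hj, ht, hV⟩
  · exact (h.le.trans (Nat.pow_le_pow_right (by norm_num) (by omega)))
  · rw [hV]
    calc (2 ^ m + t) * 2 ^ (j + 1) ≤ (2 ^ m + 2 ^ m) * 2 ^ (L.J + 1) :=
          Nat.mul_le_mul (by omega) (Nat.pow_le_pow_right (by norm_num) (by omega))
      _ = 2 ^ (m + L.J + 2) := by ring

/-- RANGE: a state plus a small letter stays below the overflow threshold on the grid. [cell] -/
theorem range_of_stZ {φ : Format} {G : ℕ} (hR : (2 : ℚ) ^ (φ.manBits + (L.J + 3)) ≤ φ.maxRat)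
    {V z : ℤ} (hV : L.stZ φ.manBits V) (hz : z.natAbs < 2 ^ (φ.manBits + 1)) :
    (((V + z).natAbs : ℕ) : ℚ) / 2 ^ G ≤ φ.maxRat := by
  apply grid_le_maxRat_of_lt hR
  have h1 := L.stZ_natAbs_le hV
  have h2 : z.natAbs < 2 ^ (φ.manBits + L.J + 2) :=
    hz.trans_le (Nat.pow_le_pow_right (by norm_num) (by omega))
  calc (V + z).natAbs ≤ V.natAbs + z.natAbs := Int.natAbs_add_le V z
    _ < 2 ^ (φ.manBits + L.J + 2) + 2 ^ (φ.manBits + L.J + 2) := by omega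
    _ = 2 ^ (φ.manBits + (L.J + 3)) := by ring
    _ ≤ 2 ^ (φ.manBits + (L.J + 3) + G) := Nat.pow_le_pow_right (by norm_num) (by omega)

/-- ONE STEP IN GRID UNITS from a state by a small letter: step, gain, deficit. [cell] -/
theorem step_grid {φ : Format} {G : ℕ} (hq : φ.qexp ≤ -(G : ℤ))
    (hR : (2 : ℚ) ^ (φ.manBits + (L.J + 3)) ≤ φ.maxRat) {V z : ℤ} (hV : L.stZ φ.manBits V)
    (hz : z.natAbs < 2 ^ (φ.manBits + 1)) :
    flStep φ ((V : ℚ) / 2 ^ G) ((z : ℚ) / 2 ^ G) = (rneZ φ.manBits (V + z) : ℚ) / 2 ^ G ∧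
    gainOf φ ((V : ℚ) / 2 ^ G) ((z : ℚ) / 2 ^ G) =
      ((rneZ φ.manBits (V + z) - V - z : ℤ) : ℚ) / 2 ^ G ∧
    deficitOf φ ((V : ℚ) / 2 ^ G) ((z : ℚ) / 2 ^ G) =
      ((|z| - (rneZ φ.manBits (V + z) - V - z) : ℤ) : ℚ) / 2 ^ G := by
  have hrng := L.range_of_stZ (G := G) hR hV hz
  exact ⟨flStep_grid_prec hq hrng, gainOf_grid_prec hq hrng,
    by rw [deficitOf_grid_prec hq hrng, Int.natCast_natAbs]⟩

/-- Grid comparisons. [folklore] -/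
theorem grid_le_iff {G : ℕ} {a b : ℤ} : (a : ℚ) / 2 ^ G ≤ (b : ℚ) / 2 ^ G ↔ a ≤ b := by
  rw [div_le_div_iff_of_pos_right (by positivity : (0 : ℚ) < 2 ^ G), Int.cast_le]

/-- Grid comparisons. [folklore] -/
theorem grid_pos_iff {G : ℕ} {a : ℤ} : 0 < (a : ℚ) / 2 ^ G ↔ 0 < a := by
  rw [div_pos_iff_of_pos_right (by positivity : (0 : ℚ) < 2 ^ G), Int.cast_pos]

/-- Grid comparisons. [folklore] -/
theorem grid_eq_zero_iff {G : ℕ} {a : ℤ} : (a : ℚ) / 2 ^ G = 0 ↔ a = 0 := by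
  rw [div_eq_zero_iff, Int.cast_eq_zero, or_iff_left (by positivity : (2 : ℚ) ^ G ≠ 0)]

/-- A CHECKED LAW IS A θ-CERTIFICATE (see the module docstring). [cell] -/
theorem lawCheck_cert (h : L.lawCheck = true) (hc : L.contOK = true) (hsucc : L.succOK = true)
    {φ : Format} {H K : ℤ} (hM2 : (2 : ℤ) ^ φ.manBits = 2 * H) (hMK : L.M0 * K = 2 * H)
    (hev : 2 ∣ K) (hK : L.K0 ≤ K) (hfix : L.fixed = true → K = L.K0) {G : ℕ}
    (hq : φ.qexp ≤ -(G : ℤ)) (hR : (2 : ℚ) ^ (φ.manBits + (L.J + 3)) ≤ φ.maxRat)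
    (hlam : ∀ z ∈ L.lam, z.natAbs < 2 ^ (φ.manBits + 1))
    (hθ : 0 < L.th1 * 2 ^ φ.manBits + L.th0) (hρ : 0 ≤ L.rhoN) (hβ : 0 ≤ L.betaN)
    (hκ : 0 < L.Bj L.kb * 2 ^ φ.manBits + L.Sj L.kb) :
    ThetaCertificate φ (L.PiL G) (L.SL G φ) (L.psiL G φ) (L.thetaL φ.manBits) L.rhoL L.betaL
      (L.kappaL φ.manBits) := by
  obtain ⟨-, -, -, hthD, hrhoD, hbetaD⟩ := L.lawCheck_side h
  have hG : (0 : ℚ) < 2 ^ G := by positivity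
  have hMm : L.M0 * K = 2 ^ φ.manBits := by rw [hMK, ← hM2]
  -- the integer certificate at a state and a letter
  have key : ∀ {V : ℤ}, L.stZ φ.manBits V → ∀ {z : ℤ}, z ∈ L.lam → _ :=
    fun {V} hV {z} hz => L.lawCheck_sound_int h hc hsucc hM2 hMK hev hK hfix hV hz rfl
  refine ⟨?_, ?_, ?_, ?_, ?_, ?_, ?_, ?_, ?_, ?_⟩
  · -- θ > 0
    unfold thetaL; exact div_pos (by exact_mod_cast hθ) (by exact_mod_cast hthD)
  · unfold rhoL; exact div_nonneg (by exact_mod_cast hρ) (by exact_mod_cast hrhoD.le)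
  · unfold betaL; exact div_nonneg (by exact_mod_cast hβ) (by exact_mod_cast hbetaD.le)
  · unfold kappaL; exact div_nonneg (by positivity) (by exact_mod_cast hκ.le)
  · -- start
    rintro q ⟨z, hz, rfl⟩
    have hzs := hlam z hz
    refine ⟨exists_toRat_eq_grid_prec hq hzs (grid_le_maxRat_of_lt hR
      (hzs.trans_le (Nat.pow_le_pow_right (by norm_num) (by omega)))), ⟨z, Or.inl hzs, rfl⟩, ?_⟩
    rw [L.psiL_grid, L.psiZ_of_natAbs_lt _ hzs, Int.cast_natCast, Nat.cast_natAbs, Int.cast_abs,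
      abs_div, abs_of_pos hG]
  · -- closed
    rintro v q ⟨V, hV, rfl⟩ ⟨z, hz, rfl⟩
    rw [(L.step_grid hq hR hV (hlam z hz)).1]
    exact ⟨_, (key hV hz).1, rfl⟩
  · -- potential
    rintro v q ⟨V, hV, rfl⟩ ⟨z, hz, rfl⟩ hne
    obtain ⟨hfl, -, hdf⟩ := L.step_grid hq hR hV (hlam z hz)
    rw [hfl] at hne ⊢
    rw [L.psiL_grid, L.psiL_grid, hdf, ← add_div, ← Int.cast_add, grid_le_iff]
    exact (key hV hz).2.2.2.1 (fun e => hne (by rw [e]))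
  · -- capacity
    rintro v q ⟨V, hV, rfl⟩ ⟨z, hz, rfl⟩ habs hq0
    obtain ⟨hfl, -, -⟩ := L.step_grid hq hR hV (hlam z hz)
    rw [hfl, div_left_inj' (by positivity : (2 : ℚ) ^ G ≠ 0), Int.cast_inj] at habs
    have hz0 : z < 0 := by
      by_contra hcon
      have : (0 : ℚ) ≤ (z : ℚ) / 2 ^ G := div_nonneg (by exact_mod_cast not_lt.1 hcon) hG.le
      linarith
    have f1 := (key hV hz).2.2.1 habs hz0
    rw [show L.th1 * L.M0 * K = L.th1 * 2 ^ φ.manBits by rw [mul_assoc, hMm]] at f1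
    have f1q : ((-z : ℤ) : ℚ) * (L.th0 + L.th1 * 2 ^ φ.manBits : ℤ) ≤
        (L.thD : ℚ) * (L.psiZ φ.manBits V : ℤ) := by exact_mod_cast f1
    push_cast at f1q
    have hthD' : (0 : ℚ) < L.thD := by exact_mod_cast hthD
    rw [L.psiL_grid]
    unfold thetaL
    rw [show (L.th1 * 2 ^ φ.manBits + L.th0 : ℚ) / L.thD * -((z : ℚ) / 2 ^ G) =
      ((L.th1 * 2 ^ φ.manBits + L.th0) * -(z : ℚ) / L.thD) / 2 ^ G by ring,
      div_le_div_iff_of_pos_right hG, div_le_iff₀ hthD']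
    linarith
  · -- paid
    rintro v q ⟨V, hV, rfl⟩ ⟨z, hz, rfl⟩ hne hpos
    obtain ⟨hfl, hgn, hdf⟩ := L.step_grid hq hR hV (hlam z hz)
    rw [hfl] at hne
    rw [hdf] at hpos ⊢
    rw [hgn]
    rw [grid_pos_iff] at hpos
    have f4 := (key hV hz).2.2.2.2.1 (fun e => hne (by rw [e])) hpos
    have f4q : ((rneZ φ.manBits (V + z) - V - z : ℤ) : ℚ) * (L.rhoD : ℤ) ≤
        ((L.rhoN : ℤ) : ℚ) * ((|z| - (rneZ φ.manBits (V + z) - V - z) : ℤ) : ℚ) := by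
      exact_mod_cast f4
    have hrhoD' : (0 : ℚ) < L.rhoD := by exact_mod_cast hrhoD
    unfold rhoL
    rw [show (L.rhoN : ℚ) / L.rhoD * (((|z| - (rneZ φ.manBits (V + z) - V - z) : ℤ) : ℚ) / 2 ^ G)
      = ((L.rhoN : ℚ) * ((|z| - (rneZ φ.manBits (V + z) - V - z) : ℤ) : ℚ) / L.rhoD) / 2 ^ G
      by ring, div_le_div_iff_of_pos_right hG, le_div_iff₀ hrhoD']
    exact f4q
  · -- free
    rintro u q ⟨V, hV, rfl⟩ ⟨z, hz, rfl⟩ hne hd0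
    obtain ⟨hfl, hgn, hdf⟩ := L.step_grid hq hR hV (hlam z hz)
    rw [hfl] at hne
    rw [hdf, grid_eq_zero_iff] at hd0
    have hne' : rneZ φ.manBits (V + z) ≠ V := fun e => hne (by rw [e])
    obtain ⟨hk, hpair⟩ := (key hV hz).2.2.2.2.2 hne' hd0
    have hst1 : L.stZ φ.manBits (rneZ φ.manBits (V + z)) := (key hV hz).1
    refine ⟨?_, ?_⟩
    · rw [hgn, L.psiL_grid]
      rw [show L.Bj L.kb * L.M0 * K = L.Bj L.kb * 2 ^ φ.manBits by rw [mul_assoc, hMm]] at hk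
      have hkq : ((rneZ φ.manBits (V + z) - V - z : ℤ) : ℚ) *
          ((L.Sj L.kb + L.Bj L.kb * 2 ^ φ.manBits : ℤ) : ℚ) ≤
          ((2 : ℤ) ^ L.kb : ℤ) * (L.psiZ φ.manBits V : ℤ) := by exact_mod_cast hk
      push_cast at hkq
      have hκ' : (0 : ℚ) < L.Bj L.kb * 2 ^ φ.manBits + L.Sj L.kb := by exact_mod_cast hκ
      unfold kappaL
      rw [show (2 : ℚ) ^ L.kb / (L.Bj L.kb * 2 ^ φ.manBits + L.Sj L.kb) *
          ((L.psiZ φ.manBits V : ℚ) / 2 ^ G) =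
        ((2 : ℚ) ^ L.kb * (L.psiZ φ.manBits V : ℚ) / (L.Bj L.kb * 2 ^ φ.manBits + L.Sj L.kb)) /
          2 ^ G by ring, div_le_div_iff_of_pos_right hG, le_div_iff₀ hκ']
      push_cast
      linarith
    · rintro q' ⟨z₂, hz₂, rfl⟩ hne₂
      rw [hfl] at hne₂ ⊢
      rw [hgn]
      obtain ⟨hfl₂, hgn₂, hdf₂⟩ := L.step_grid hq hR hst1 (hlam z₂ hz₂)
      rw [hfl₂] at hne₂
      rw [hgn₂, hdf₂]
      rcases hpair z₂ hz₂ _ rfl with he | ⟨-, hle⟩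
      · exact absurd (by rw [he]) hne₂
      · have hleq : (((rneZ φ.manBits (V + z) - V - z) +
            (rneZ φ.manBits (rneZ φ.manBits (V + z) + z₂) - rneZ φ.manBits (V + z) - z₂) : ℤ) : ℚ)
            * (L.betaD : ℤ) ≤ ((L.betaN : ℤ) : ℚ) *
            ((|z₂| - (rneZ φ.manBits (rneZ φ.manBits (V + z) + z₂) - rneZ φ.manBits (V + z) - z₂)
              : ℤ) : ℚ) := by exact_mod_cast hle
        have hbetaD' : (0 : ℚ) < L.betaD := by exact_mod_cast hbetaD
        unfold betaL
        rw [← add_div, ← Int.cast_add,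
          show (L.betaN : ℚ) / L.betaD * (((|z₂| - (rneZ φ.manBits (rneZ φ.manBits (V + z) + z₂)
            - rneZ φ.manBits (V + z) - z₂) : ℤ) : ℚ) / 2 ^ G) =
            ((L.betaN : ℚ) * (((|z₂| - (rneZ φ.manBits (rneZ φ.manBits (V + z) + z₂)
            - rneZ φ.manBits (V + z) - z₂) : ℤ) : ℚ)) / L.betaD) / 2 ^ G by ring,
          div_le_div_iff_of_pos_right hG, le_div_iff₀ hbetaD']
        exact hleq

end LawData

end ThetaLaw

end MiniFloat

end Literature.ComputerArithmetic.FloatingPoint
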